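import Summits.HodgeConjecture.HodgeConjecture.Theorems.Ring2HypothesesDescentMotivatedCorrespondenceLift
import HarnessLib

/-!
# Ring 2 hypotheses, descent face — ANDRÉ'S THM. 0.4 SEMISIMPLICITY AT REALISATION LEVEL: the lift along an arbitrary
# MOTIVATED correspondence (the morphisms of André's category), real carriers

research route conditional on HC_CM; not a corollary; Q11.4-sentence-2 already refuted in dim ≥ 3.
Cell `pub-hodge-ring2` (Hodge ladder STAGE 3), seat `ring2-b05` (binder row b05
`Ring2.Hypotheses.MotivatedImpliesAlgebraicAV`), gen 40, file 4. `HC_CM` (`Theses.RankFourFaces.CMAbelianHodge`) does not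
occur in this file; nothing here proves a case of the Hodge conjecture; no binder is discharged; row b05 stays OPEN.

André 1996, §4 and Thm. 0.4 (p. 7): the morphisms `h(Y) → h(V)` of the category of motives `𝓜(𝒱)` are the MOTIVATED
correspondences `C⁰_mot(Y, V) = A_mot^{dim Y}(Y × V)` (§2.1 Déf. 2, §4.1), and `𝓜(𝒱)` is abelian SEMISIMPLE; hence the
image of a morphism is a direct summand and `Hom(𝟙, ·)` — the motivated classes of the realisation — is exact: a
motivated class of `V` lying in `u_*(H(Y))` is `u_*` of a motivated class of `Y`. The companion
`Ring2HypothesesDescentMotivatedCorrespondenceLift.lean` (same gen) proved this for ALGEBRAIC correspondences `u`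
(the case packaged by `HodgeTheory.IsAlgebraicCorrespondence`, enough for Arapura's domination); this file removes that
restriction — `u` any MOTIVATED class on `V ⊗ Y` — with the same engine, André's Prop. 2.1 (i) (`A_mot` is a ring:
gen 35's `cupProduct_mem_motivatedClasses`) replacing «algebraic ∪ motivated is motivated»:

* §1 `gysinMap_snd_cupProduct_map_fst_mem_motivatedClasses_of_motivated` — the adjoint class `snd_*(u ∪ fst^* b)` of a
  MOTIVATED `u` at a motivated `b` is motivated; `cupProduct_corrClassAction_eq_zero_of_forall_motivated_of_motivated` —
  orthogonality of a motivated `b` to `u_*(A_mot(Y))` propagates to the whole range `u_*(H(Y))` (Prop. 3.3).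
* §2 **`exists_mem_motivatedClasses_corrClassAction_eq_of_motivated` — THE LIFT ALONG A MOTIVATED CORRESPONDENCE**:
  `c ∈ A_motᵖ(V)_ℂ ∩ u_*(H^{2p'}(Y(ℂ); ℂ))` ⟹ `c = u_*(y)` with `y ∈ A_mot^{p'}(Y)_ℂ`; submodule form
  `motivatedClasses_inf_range_corrClassAction_eq_map_of_motivated`: `A_motᵖ(V) ∩ u_*(H(Y)) = u_*(A_mot^{p'}(Y))`
  (`⊇`: André's Corollaire p. 15, gen 35's `corrClassAction_mem_motivatedClasses_of_motivated`).

HONEST COLUMN. No definition, no named fact (new or displayed), no sorry; fact-free kernel theorems. Not claimed: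
the category `𝓜(𝒱)` itself, its abelianness/semisimplicity as such (no category of motives in the tree) — only this
realisation-level consequence; nothing on row b05's residue X.

PRESEARCH: [corpus: `paper:doi-10-1007-bf02698643` André 1996 Thm. 0.4 p. 7, §2.1 Déf. 2 / Corollaire pp. 14–15,
Prop. 3.3 pp. 21–22, §4 pp. 22–24, re-opened this session]; Jannsen 1992 (Invent. Math. 107) Thm. 1 (semisimplicity
⟺ numerical equivalence) cite-only; corpus + galaxy as in the companions: the realisation-level lift is not a printed
statement — certification by assembly, no novelty in print claimed.

References (bib keys): Andre1996Motifs (Thm. 0.4 p. 7, §2.1 pp. 14–15, Prop. 3.3 pp. 21–22, §4.1 p. 22), Jannsen1992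
(Thm. 1), FultonYoungTableaux1997 (App. B §B.1 (5)–(6)), HatcherAT2002 (§3.3 Thm. 3.26, Prop. 3.38).
-/

noncomputable section

-- every declaration of this problem lives in `Summit.HodgeConjecture.HodgeConjecture.…` (summit = sub-problem)
set_option linter.dupNamespace false

open CategoryTheory AlgebraicGeometry MonoidalCategory CartesianMonoidalCategory
open Literature.AlgebraicTopology.SingularHomology Literature.Geometry.Kaehler
open Literature.AlgebraicGeometry Literature.AlgebraicGeometry.Motives
  Literature.AlgebraicGeometry.HodgeTheory

namespace Summit.HodgeConjecture.HodgeConjecture.Theorems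

variable {m n : ℕ} {V Y : SchemeOver ℂ}

/-! ## §1 The adjoint class of a motivated correspondence -/

/-- **The adjoint class of a MOTIVATED correspondence at a motivated class is motivated**: for
`u ∈ A_motᵉ(V ⊗ Y)_ℂ` and `b ∈ A_motʳ(V)_ℂ`, `snd_*(u ∪ fst^* b) ∈ A_mot^{p''}(Y)_ℂ` — `fst^* b` is motivated (André
Prop. 2.1 (ii), gen 34's `map_fst_mem_motivatedClasses`), `A_mot(V ⊗ Y)` is closed under `∪` (Prop. 2.1 (i), gen 35's
`cupProduct_mem_motivatedClasses`), `snd_*` preserves motivated classes for any orientations with Poincaré duality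
(Prop. 2.1 (ii), the tree's `gysinMap_snd_mem_motivatedClasses`). [cite: Andre1996Motifs, Prop. 2.1 (pp. 14–15)] -/
theorem gysinMap_snd_cupProduct_map_fst_mem_motivatedClasses_of_motivated (hV : IsSmoothProjective m V)
    (hY : IsSmoothProjective n Y) (μ : HomologicalOrientation ℂ (ComplexPoints (V ⊗ Y)) (2 * (m + n)))
    (hμ : μ.HasPoincareDuality) {e r p' p'' : ℕ} (h₁ : 2 * e + 2 * r = 2 * (p'' + m))
    (H₁ : 2 * (p'' + m) + 2 * p' = 2 * (m + n)) (H₂ : 2 * p'' + 2 * p' = 2 * n)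
    {u : complexBetti (V ⊗ Y) (2 * e)} (hu : u ∈ motivatedClasses (m + n) (V ⊗ Y) e) {b : complexBetti V (2 * r)}
    (hb : b ∈ motivatedClasses m V r) :
    gysinMap μ (complexOrientationFamily hY) (AlgPoints.mapContinuous (L := ℂ) (snd V Y)) H₁ H₂
        (cupProduct h₁ u (complexBetti.map (fst V Y) (2 * r) b)) ∈ motivatedClasses n Y p'' := by
  have hVY : IsSmoothProjective (m + n) (V ⊗ Y) := IsSmoothProjective.tensor_holds hV hY
  have hfst : complexBetti.map (fst V Y) (2 * r) b ∈ motivatedClasses (m + n) (V ⊗ Y) r :=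
    map_fst_mem_motivatedClasses hV hY r hb
  have hcup : cupProduct h₁ u (complexBetti.map (fst V Y) (2 * r) b) ∈
      motivatedClasses (m + n) (V ⊗ Y) (p'' + m) :=
    cupProduct_mem_motivatedClasses hVY h₁ hu hfst
  exact gysinMap_snd_mem_motivatedClasses hV hY μ (complexOrientationFamily hY) hμ
    (hasPoincareDuality_complexOrientationFamily hY) H₁ H₂ hcup

/-- **If a motivated `b ∈ A_motʳ(V)_ℂ` (`p + r = m`) is cup-orthogonal to `u_*(A_mot^{p'}(Y)_ℂ)` for a MOTIVATED
correspondence `u ∈ A_motᵉ(V ⊗ Y)_ℂ` (`u_* = fst_*(snd^*(·) ∪ u) : H^{2p'}(Y(ℂ)) → H^{2p}(V(ℂ))`, any orientations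
`μ`, `ν` with Poincaré duality), then `u_*(y₀) ∪ b = 0` for EVERY `y₀`**: the adjoint class `s = snd_*(u ∪ fst^* b)` is
motivated (§1) with `⟨s ∪ y, [Y]⟩ = ⟨u_* y ∪ b, [V]_ν⟩ = 0` for all motivated `y` (companion's
`cupPairing_corrClassAction_eq_cupPairing_gysinMap_snd`), so `s = 0` by André Prop. 3.3 (gen 36's
`nondegenerate_motivatedClasses`), and `⟨u_* y₀ ∪ b, [V]_ν⟩ = ⟨s ∪ y₀, [Y]⟩ = 0`. [cite: Andre1996Motifs, Prop. 3.3 (pp. 21–22) and Thm. 0.4 (p. 7)]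
[cite: FultonYoungTableaux1997, Appendix B §B.1 (5)–(6)] -/
theorem cupProduct_corrClassAction_eq_zero_of_forall_motivated_of_motivated (hV : IsSmoothProjective m V)
    (hY : IsSmoothProjective n Y) (μ : HomologicalOrientation ℂ (ComplexPoints (V ⊗ Y)) (2 * (m + n)))
    (ν : HomologicalOrientation ℂ (ComplexPoints V) (2 * m)) (hμ : μ.HasPoincareDuality) (hν : ν.HasPoincareDuality)
    {e p p' r : ℕ} (hab : 2 * p' + 2 * e = 2 * p + 2 * n) (hq : 2 * p + 2 * r = 2 * m)
    {u : complexBetti (V ⊗ Y) (2 * e)} (hu : u ∈ motivatedClasses (m + n) (V ⊗ Y) e)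
    {b : complexBetti V (2 * r)} (hb : b ∈ motivatedClasses m V r)
    (horth : ∀ y ∈ motivatedClasses n Y p', cupProduct hq (corrClassAction μ ν hab hq u y) b = 0)
    (y₀ : complexBetti Y (2 * p')) : cupProduct hq (corrClassAction μ ν hab hq u y₀) b = 0 := by
  classical
  -- no classes of degree `2p' > 2n`
  by_cases hp'n : n < p'
  · haveI := subsingleton_complexBetti hY (show 2 * n < 2 * p' by omega)
    rw [Subsingleton.elim y₀ 0, map_zero, map_zero, LinearMap.zero_apply]
  obtain ⟨p'', hp''⟩ : ∃ p'', p' + p'' = n := ⟨n - p', by omega⟩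
  have h₁ : 2 * e + 2 * r = 2 * (p'' + m) := by omega
  have H₁ : 2 * (p'' + m) + 2 * p' = 2 * (m + n) := by omega
  have H₂ : 2 * p'' + 2 * p' = 2 * n := by omega
  -- the adjoint class is motivated and cup-orthogonal to `A_mot^{p'}(Y)`, hence zero
  have hs := gysinMap_snd_cupProduct_map_fst_mem_motivatedClasses_of_motivated hV hY μ hμ h₁ H₁ H₂ hu hb
  have hs0 : gysinMap μ (complexOrientationFamily hY) (AlgPoints.mapContinuous (L := ℂ) (snd V Y)) H₁ H₂
      (cupProduct h₁ u (complexBetti.map (fst V Y) (2 * r) b)) = 0 := by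
    refine (nondegenerate_motivatedClasses hY (show p'' + p' = n by omega)).1 _ hs fun y hy ↦ ?_
    refine cupProduct_eq_zero_of_cupPairing_eq_zero complexOrientationFamily hY _ ?_
    rw [← cupPairing_corrClassAction_eq_cupPairing_gysinMap_snd hY μ ν hν hab hq h₁ H₁ H₂ u y b,
      cupPairing_apply, horth y hy, map_zero, LinearMap.zero_apply]
  refine eq_zero_of_kroneckerPairing_eq_zero_of_orientation hV ν ?_
  rw [← cupPairing_apply, cupPairing_corrClassAction_eq_cupPairing_gysinMap_snd hY μ ν hν hab hq h₁ H₁ H₂ u y₀ b,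
    hs0, map_zero, LinearMap.zero_apply]

/-! ## §2 The lift along a motivated correspondence -/

/-- **ANDRÉ'S THM. 0.4 SEMISIMPLICITY AT REALISATION LEVEL — THE LIFT ALONG A MOTIVATED CORRESPONDENCE.** `V`, `Y`
smooth projective complex varieties of dimensions `m`, `n`; `u ∈ A_motᵉ(V ⊗ Y)_ℂ` a MOTIVATED correspondence, acting
as `u_* = fst_*(snd^*(·) ∪ u) : H^{2p'}(Y(ℂ); ℂ) → H^{2p}(V(ℂ); ℂ)` (`HodgeTheory.corrClassAction μ ν`, any
orientations with Poincaré duality, `2p' + 2e = 2p + 2n`, `2p + q = 2m`); `c ∈ A_motᵖ(V)_ℂ` a motivated class in the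
range of `u_*`. Then `c = u_*(y)` for a MOTIVATED `y ∈ A_mot^{p'}(Y)_ℂ`. (In print: `u` is a morphism `h(Y)(·) → h(V)(·)`
of André's semisimple category, its image is a direct summand, motivated classes of the image lift.) Proof:
`W := u_*(A_mot^{p'}(Y)) ≤ A_motᵖ(V)` (Corollaire p. 15, gen 35's `corrClassAction_mem_motivatedClasses_of_motivated`);
a motivated `b` of complementary codimension orthogonal to `W` is orthogonal to the whole range (§1); `c ∈ W^⊥⊥ = W`
(Prop. 3.3 on `V`, gen 36's `mem_of_forall_orthogonal`). [cite: Andre1996Motifs, Thm. 0.4 (p. 7), §2.1 Corollaire (p. 15) and Prop. 3.3 (pp. 21–22)]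
[cite: Jannsen1992, Thm. 1] -/
theorem exists_mem_motivatedClasses_corrClassAction_eq_of_motivated (hV : IsSmoothProjective m V)
    (hY : IsSmoothProjective n Y) (μ : HomologicalOrientation ℂ (ComplexPoints (V ⊗ Y)) (2 * (m + n)))
    (ν : HomologicalOrientation ℂ (ComplexPoints V) (2 * m)) (hμ : μ.HasPoincareDuality) (hν : ν.HasPoincareDuality)
    {e p p' q : ℕ} (hab : 2 * p' + 2 * e = 2 * p + 2 * n) (hq : 2 * p + q = 2 * m)
    {u : complexBetti (V ⊗ Y) (2 * e)} (hu : u ∈ motivatedClasses (m + n) (V ⊗ Y) e)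
    {c : complexBetti V (2 * p)} (hc : c ∈ motivatedClasses m V p)
    (hcu : c ∈ LinearMap.range (corrClassAction μ ν hab hq u)) :
    ∃ y ∈ motivatedClasses n Y p', corrClassAction μ ν hab hq u y = c := by
  classical
  obtain ⟨r, hr⟩ : ∃ r, q = 2 * r := ⟨m - p, by omega⟩
  subst hr
  have hpr : p + r = m := by omega
  obtain ⟨y₀, rfl⟩ := hcu
  set W : Submodule ℂ (complexBetti V (2 * p)) := (motivatedClasses n Y p').map (corrClassAction μ ν hab hq u)
    with hWdef
  have hWle : W ≤ motivatedClasses m V p := by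
    rintro _ ⟨y, hy, rfl⟩
    exact corrClassAction_mem_motivatedClasses_of_motivated hV hY μ ν hμ hν hab hq hu hy
  haveI := finite_complexBetti hV (2 * p)
  haveI := finite_complexBetti hV (2 * r)
  haveI := finite_complexBetti hV (2 * m)
  obtain ⟨hD₁, hD₂⟩ := nondegenerate_motivatedClasses hV hpr
  have hmem : corrClassAction μ ν hab hq u y₀ ∈ W :=
    mem_of_forall_orthogonal (Ring2.Hypotheses.finrank_complexBetti_top hV) (cupProduct hq) (motivatedClasses m V p)
      (motivatedClasses m V r) hD₁ hD₂ hWle hc fun b hb hbW ↦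
        cupProduct_corrClassAction_eq_zero_of_forall_motivated_of_motivated hV hY μ ν hμ hν hab hq hu hb
          (fun y hy ↦ hbW _ ⟨y, hy, rfl⟩) y₀
  obtain ⟨y, hy, hyc⟩ := hmem
  exact ⟨y, hy, hyc⟩

/-- **Submodule form: `A_motᵖ(V) ∩ u_*(H^{2p'}(Y)) = u_*(A_mot^{p'}(Y))` for a motivated correspondence `u`**
(`⊇`: André's Corollaire p. 15; `⊆`: the lift). The exactness of «motivated classes of» on the image of a morphism
of motives. [cite: Andre1996Motifs, Thm. 0.4 (p. 7) and §2.1 Corollaire (p. 15)] -/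
theorem motivatedClasses_inf_range_corrClassAction_eq_map_of_motivated (hV : IsSmoothProjective m V)
    (hY : IsSmoothProjective n Y) (μ : HomologicalOrientation ℂ (ComplexPoints (V ⊗ Y)) (2 * (m + n)))
    (ν : HomologicalOrientation ℂ (ComplexPoints V) (2 * m)) (hμ : μ.HasPoincareDuality) (hν : ν.HasPoincareDuality)
    {e p p' q : ℕ} (hab : 2 * p' + 2 * e = 2 * p + 2 * n) (hq : 2 * p + q = 2 * m)
    {u : complexBetti (V ⊗ Y) (2 * e)} (hu : u ∈ motivatedClasses (m + n) (V ⊗ Y) e) :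
    motivatedClasses m V p ⊓ LinearMap.range (corrClassAction μ ν hab hq u) =
      (motivatedClasses n Y p').map (corrClassAction μ ν hab hq u) := by
  obtain ⟨r, hr⟩ : ∃ r, q = 2 * r := ⟨m - p, by omega⟩
  subst hr
  refine le_antisymm (fun c hc ↦ ?_) ?_
  · obtain ⟨y, hy, hyc⟩ :=
      exists_mem_motivatedClasses_corrClassAction_eq_of_motivated hV hY μ ν hμ hν hab hq hu hc.1 hc.2
    exact ⟨y, hy, hyc⟩
  · rintro _ ⟨y, hy, rfl⟩
    exact ⟨corrClassAction_mem_motivatedClasses_of_motivated hV hY μ ν hμ hν hab hq hu hy,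
      LinearMap.mem_range_self _ y⟩

end Summit.HodgeConjecture.HodgeConjecture.Theorems

end
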